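import Summits.ValiantsHypothesis.ValiantsHypothesis.Theorems.BarrierLeverPriorityPeelingShearMove

/-!
# Route BarrierLever — priority peeling for TT: the moves over a GENERAL index type, and the
# common good point

Helper file (`--supports stmt-ValiantsHypothesis-19152`; cell valiant-natproofs, rung V4, 𝒟-side;
prover gen 7; memo `HOME/prover/gen7/PP-MEMO-g7.md` §5). Closes NO item. `pairMove` / `shearMove`
(tree files `…PriorityPeelingPairMove`, `…PriorityPeelingShearMove`) index the rows and columns of a
configuration by `Fin r`; the children of a pair move are indexed by the SUBTYPES
`{x // β x = false}`, `{x // ¬ β x = false}`, so a recursion over certificates wants the moves for an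
arbitrary finite index type `ι`. This file restates both moves for general `ι` (`pairMove'`,
`shearMove'`; same proofs) and supplies the COMMON GOOD POINT (`exists_common_of_alive`): two
configurations that are alive separately are alive for one and the same matrix (the two layout
determinants are nonzero polynomial functions of the matrix entries, `MvPolynomial.funext`), which
turns the «one `G'` for both children» hypothesis of the pair move into «each child alive».

WHAT THIS IS NOT: bookkeeping; nothing on the existence of peeling certificates, on TT / TNS / item
19717 in general, on crux stmt-ValiantsHypothesis-14610, or on `VP` versus `VNP`.
-/

-- layout Summits/ValiantsHypothesis/ValiantsHypothesis forces the duplicated namespace component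
set_option linter.dupNamespace false

namespace Summit.ValiantsHypothesis.ValiantsHypothesis.Theorems.BarrierLever.PriorityPeeling

open Finset Polynomial Matrix

variable {nr nc : ℕ}

/-! ## 1. Layout determinants commute with ring maps; the common good point -/

/-- Applying a ring map entrywise commutes with forming the layout determinant. -/
theorem map_layoutDet {A B : Type*} [CommRing A] [CommRing B] (φ : A →+* B) {ι : Type*}
    [Fintype ι] [DecidableEq ι] {e : ℕ} (R : ι → Fin e → Fin nr) (C : ι → Fin e → Fin nc)
    (M : Matrix (Fin nr) (Fin nc) A) :
    φ (Matrix.of fun i j : ι => (M.submatrix (R i) (C j)).det).det =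
      (Matrix.of fun i j : ι => ((M.map φ).submatrix (R i) (C j)).det).det := by
  rw [RingHom.map_det]
  congr 1
  refine Matrix.ext (fun i j => ?_)
  rw [RingHom.mapMatrix_apply, Matrix.map_apply, Matrix.of_apply, Matrix.of_apply, RingHom.map_det,
    RingHom.mapMatrix_apply, Matrix.submatrix_map]

/-- The layout determinant as a polynomial in the matrix entries: evaluating the generic layout
determinant at `G` gives the layout determinant of `G`. -/
theorem eval_genericLayoutDet {ι : Type*} [Fintype ι] [DecidableEq ι] {e : ℕ}
    (R : ι → Fin e → Fin nr) (C : ι → Fin e → Fin nc) (G : Matrix (Fin nr) (Fin nc) ℂ) :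
    MvPolynomial.eval (fun p : Fin nr × Fin nc => G p.1 p.2)
      (Matrix.of fun i j : ι => ((Matrix.of fun a m => MvPolynomial.X (a, m) :
        Matrix (Fin nr) (Fin nc) (MvPolynomial (Fin nr × Fin nc) ℂ)).submatrix (R i) (C j)).det).det =
      (Matrix.of fun i j : ι => (G.submatrix (R i) (C j)).det).det := by
  have hM : ((Matrix.of fun a m => MvPolynomial.X (a, m) :
      Matrix (Fin nr) (Fin nc) (MvPolynomial (Fin nr × Fin nc) ℂ)).map
        (MvPolynomial.eval (fun p : Fin nr × Fin nc => G p.1 p.2))) = G := by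
    ext a m
    simp only [Matrix.map_apply, Matrix.of_apply, MvPolynomial.eval_X]
  rw [map_layoutDet, hM]

/-- **Common good point.** Two configurations (over the same literal spaces) that are alive
separately are alive for one and the same matrix. -/
theorem exists_common_of_alive {ι κ : Type*} [Fintype ι] [DecidableEq ι] [Fintype κ]
    [DecidableEq κ] {e e' : ℕ} (R : ι → Fin e → Fin nr) (C : ι → Fin e → Fin nc)
    (R' : κ → Fin e' → Fin nr) (C' : κ → Fin e' → Fin nc)
    (h : ∃ G : Matrix (Fin nr) (Fin nc) ℂ, (Matrix.of fun i j : ι => (G.submatrix (R i) (C j)).det).det ≠ 0)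
    (h' : ∃ G : Matrix (Fin nr) (Fin nc) ℂ,
      (Matrix.of fun i j : κ => (G.submatrix (R' i) (C' j)).det).det ≠ 0) :
    ∃ G : Matrix (Fin nr) (Fin nc) ℂ, (Matrix.of fun i j : ι => (G.submatrix (R i) (C j)).det).det ≠ 0 ∧
      (Matrix.of fun i j : κ => (G.submatrix (R' i) (C' j)).det).det ≠ 0 := by
  set Xg : Matrix (Fin nr) (Fin nc) (MvPolynomial (Fin nr × Fin nc) ℂ) :=
    Matrix.of fun a m => MvPolynomial.X (a, m) with hXg
  set P := (Matrix.of fun i j : ι => (Xg.submatrix (R i) (C j)).det).det with hP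
  set Q := (Matrix.of fun i j : κ => (Xg.submatrix (R' i) (C' j)).det).det with hQ
  have hP0 : P ≠ 0 := by
    obtain ⟨G, hG⟩ := h
    intro h0
    apply hG
    rw [← eval_genericLayoutDet R C G, ← hXg, ← hP, h0, map_zero]
  have hQ0 : Q ≠ 0 := by
    obtain ⟨G, hG⟩ := h'
    intro h0
    apply hG
    rw [← eval_genericLayoutDet R' C' G, ← hXg, ← hQ, h0, map_zero]
  have hPQ : P * Q ≠ 0 := mul_ne_zero hP0 hQ0
  obtain ⟨v, hv⟩ : ∃ v : Fin nr × Fin nc → ℂ, MvPolynomial.eval v (P * Q) ≠ 0 := by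
    by_contra hcon
    push Not at hcon
    exact hPQ (MvPolynomial.funext fun v => by rw [hcon v, map_zero])
  rw [map_mul] at hv
  refine ⟨Matrix.of fun a m => v (a, m), ?_, ?_⟩
  · have := left_ne_zero_of_mul hv
    rwa [hP, hXg, show v = (fun p : Fin nr × Fin nc => (Matrix.of fun a m => v (a, m) :
      Matrix (Fin nr) (Fin nc) ℂ) p.1 p.2) from funext fun p => by simp,
      eval_genericLayoutDet R C] at this
  · have := right_ne_zero_of_mul hv
    rwa [hQ, hXg, show v = (fun p : Fin nr × Fin nc => (Matrix.of fun a m => v (a, m) :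
      Matrix (Fin nr) (Fin nc) ℂ) p.1 p.2) from funext fun p => by simp,
      eval_genericLayoutDet R' C'] at this

/-! ## 2. The pair move over a general index type -/

/-- **The pair move**, rows and columns indexed by an arbitrary finite type `ι` (statement and proof
as `pairMove`); the two children may be certified by DIFFERENT matrices (`exists_common_of_alive`). -/
theorem pairMove' {ι : Type*} [Fintype ι] [DecidableEq ι] {d : ℕ}
    (R : ι → Fin (d + 1) → Fin nr) (C : ι → Fin (d + 1) → Fin nc)
    (ℓ₀ ℓ₁ : Fin nr) (hℓ : ℓ₀ ≠ ℓ₁) (β : ι → Bool) (pos : ι → Fin (d + 1))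
    (hpos : ∀ i, R i (pos i) = if β i then ℓ₁ else ℓ₀)
    (huniq : ∀ i a, a ≠ pos i → R i a ≠ ℓ₀ ∧ R i a ≠ ℓ₁)
    (P S : Finset (Fin nc)) (w : Fin nc → ℕ) (grp : ι → Bool) (qφ : ι → Fin (d + 1))
    (hφ₀ : ∀ j, grp j = false → C j (qφ j) ∈ P ∧
      ∀ q, C j q ∈ P → q ≠ qφ j → w (C j q) < w (C j (qφ j)))
    (hφ₁ : ∀ j, grp j = true → (∀ q, C j q ∉ P) ∧ C j (qφ j) ∈ S ∧
      ∀ q, C j q ∈ S → q ≠ qφ j → w (C j q) < w (C j (qφ j)))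
    (f : Equiv.Perm ι) (hf : ∀ i, β i = grp (f i))
    (h₀ : ∃ G' : Matrix (Fin nr) (Fin nc) ℂ, (Matrix.of fun i j : {x : ι // β x = false} =>
        (G'.submatrix (R i ∘ (pos i).succAbove) (C (f j) ∘ (qφ (f j)).succAbove)).det).det ≠ 0)
    (h₁ : ∃ G' : Matrix (Fin nr) (Fin nc) ℂ, (Matrix.of fun i j : {x : ι // ¬ β x = false} =>
        (G'.submatrix (R i ∘ (pos i).succAbove) (C (f j) ∘ (qφ (f j)).succAbove)).det).det ≠ 0) :
    ∃ G : Matrix (Fin nr) (Fin nc) ℂ,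
      (Matrix.of fun i j : ι => (G.submatrix (R i) (C j)).det).det ≠ 0 := by
  obtain ⟨G', h₀, h₁⟩ := exists_common_of_alive _ _ _ _ h₀ h₁
  set Gp := (Matrix.of fun x m => if x = ℓ₀ then (if m ∈ P then X ^ (w m) else 0)
      else if x = ℓ₁ then (if m ∈ S then X ^ (w m) else 0) else Polynomial.C (G' x m) :
      Matrix (Fin nr) (Fin nc) ℂ[X]) with hGp_def
  set Lp : Matrix ι ι ℂ[X] := Matrix.of fun i j : ι => (Gp.submatrix (R i) (C j)).det with hLp_def
  have hpos₀ : ∀ i, β i = false → R i (pos i) = ℓ₀ := fun i hi => by rw [hpos i, hi]; rfl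
  have hpos₁ : ∀ i, ¬ β i = false → R i (pos i) = ℓ₁ := fun i hi => by
    rw [hpos i, (bool_eq_true_of_not_eq_false hi)]; rfl
  have havoid₀ : ∀ i, β i = false → ∀ a, R i a ≠ ℓ₁ := by
    intro i hi a
    by_cases ha : a = pos i
    · rw [ha, hpos₀ i hi]; exact hℓ
    · exact (huniq i a ha).2
  have havoid₁ : ∀ i, ¬ β i = false → ∀ a, R i a ≠ ℓ₀ := by
    intro i hi a
    by_cases ha : a = pos i
    · rw [ha, hpos₁ i hi]; exact hℓ.symm
    · exact (huniq i a ha).1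
  have hperm : Lp.det = 0 → (Lp.submatrix id f).det = 0 := fun h => by
    rw [Matrix.det_permute', h, mul_zero]
  have hzero : ∀ i, β i = false → ∀ i', ¬ β i' = false → (Lp.submatrix id f) i i' = 0 := by
    intro i hi i' hi'
    have hg : grp (f i') = true := by
      have := hf i'
      rw [bool_eq_true_of_not_eq_false hi'] at this
      exact this.symm
    rw [Matrix.submatrix_apply, id_eq, hLp_def, Matrix.of_apply]
    exact minor_eq_zero_of_avoids G' ℓ₀ ℓ₁ P S w (R i) (C (f i')) (pos i) (hpos₀ i hi)
      (fun a ha => (huniq i a ha).1) (havoid₀ i hi) (hφ₁ (f i') hg).1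
  have hblock := Matrix.twoBlockTriangular_det' (Lp.submatrix id f) (fun i => β i = false) hzero
  have hB₀ : ((Lp.submatrix id f).toSquareBlockProp (fun i => β i = false)).det ≠ 0 := by
    rw [Matrix.toSquareBlockProp_def]
    have heq : (Matrix.of fun i j : {x : ι // β x = false} => (Lp.submatrix id f) ↑i ↑j) =
        Matrix.of fun i j : {x : ι // β x = false} =>
          ((Matrix.of fun x m => if x = ℓ₀ then (if m ∈ P then X ^ (w m) else 0)
      else if x = ℓ₁ then (if m ∈ S then X ^ (w m) else 0) else Polynomial.C (G' x m) :
      Matrix (Fin nr) (Fin nc) ℂ[X]).submatrix (R i) (C (f j))).det := by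
      refine Matrix.ext (fun i j => ?_)
      rw [Matrix.of_apply, Matrix.of_apply, Matrix.submatrix_apply, id_eq, hLp_def, Matrix.of_apply,
        hGp_def]
    rw [heq]
    have hg0 : ∀ j : {x : ι // β x = false}, grp (f j) = false := by
      intro j
      have := hf j
      rw [j.2] at this
      exact this.symm
    exact det_block_ne_zero (ι := {x : ι // β x = false}) G' ℓ₀ ℓ₁ P S w
      (fun i => R i) (fun j => C (f j)) (fun i => pos i) (fun j => qφ (f j))
      (fun i => hpos₀ i i.2) (fun i a ha => (huniq i a ha).1) (fun i => havoid₀ i i.2)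
      (fun j => (hφ₀ (f j) (hg0 j)).1) (fun j => (hφ₀ (f j) (hg0 j)).2) h₀
  have hB₁ : ((Lp.submatrix id f).toSquareBlockProp (fun i => ¬ β i = false)).det ≠ 0 := by
    rw [Matrix.toSquareBlockProp_def]
    have heq : (Matrix.of fun i j : {x : ι // ¬ β x = false} => (Lp.submatrix id f) ↑i ↑j) =
        Matrix.of fun i j : {x : ι // ¬ β x = false} =>
          ((Matrix.of fun x m => if x = ℓ₁ then (if m ∈ S then X ^ (w m) else 0)
      else if x = ℓ₀ then (if m ∈ P then X ^ (w m) else 0) else Polynomial.C (G' x m) :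
      Matrix (Fin nr) (Fin nc) ℂ[X]).submatrix (R i) (C (f j))).det := by
      refine Matrix.ext (fun i j => ?_)
      rw [Matrix.of_apply, Matrix.of_apply, Matrix.submatrix_apply, id_eq, hLp_def, Matrix.of_apply,
        hGp_def, specialise_swap G' ℓ₀ ℓ₁ hℓ]
    rw [heq]
    have hg : ∀ j : {x : ι // ¬ β x = false}, grp (f j) = true := by
      intro j
      have := hf j
      rw [bool_eq_true_of_not_eq_false j.2] at this
      exact this.symm
    exact det_block_ne_zero (ι := {x : ι // ¬ β x = false}) G' ℓ₁ ℓ₀ S P w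
      (fun i => R i) (fun j => C (f j)) (fun i => pos i) (fun j => qφ (f j))
      (fun i => hpos₁ i i.2) (fun i a ha => (huniq i a ha).2) (fun i => havoid₁ i i.2)
      (fun j => (hφ₁ (f j) (hg j)).2.1) (fun j => (hφ₁ (f j) (hg j)).2.2) h₁
  have hLp : Lp.det ≠ 0 := by
    intro h0
    have := hperm h0
    rw [hblock] at this
    exact mul_ne_zero hB₀ hB₁ this
  obtain ⟨t, ht⟩ := exists_eval_ne_zero_of_ne_zero _ hLp
  refine ⟨Gp.map (Polynomial.eval t), ?_⟩
  rw [← Polynomial.coe_evalRingHom, ← map_layoutDet]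
  exact ht

/-! ## 3. The shear move over a general index type -/

/-- **The shear move**, rows and columns indexed by an arbitrary finite type `ι` (statement and
proof as `shearMove`). -/
theorem shearMove' {ι : Type*} [Fintype ι] [DecidableEq ι] {e : ℕ}
    (R : ι → Fin e → Fin nr) (C : ι → Fin e → Fin nc)
    (hC : ∀ j, Function.Injective (C j)) (x y : Fin nc) (hxy : x ≠ y) (aff : ι → Bool)
    (qx : ι → Fin e)
    (haff : ∀ j, aff j = true → C j (qx j) = x ∧ ∀ q, C j q ≠ y)
    (hunaff : ∀ j, aff j = false → (∀ q, C j q ≠ x) ∨ (∃ q, C j q = y))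
    (hsheared : ∃ G' : Matrix (Fin nr) (Fin nc) ℂ,
      (Matrix.of fun i j : ι => (G'.submatrix (R i)
        (if aff j then Function.update (C j) (qx j) y else C j)).det).det ≠ 0) :
    ∃ G : Matrix (Fin nr) (Fin nc) ℂ,
      (Matrix.of fun i j : ι => (G.submatrix (R i) (C j)).det).det ≠ 0 := by
  obtain ⟨G', hG'⟩ := hsheared
  set Gs : Matrix (Fin nr) (Fin nc) ℂ[X] := (Matrix.of fun a m =>
    if m = x then Polynomial.C (G' a x) + X * Polynomial.C (G' a y) else Polynomial.C (G' a m))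
    with hGs_def
  set Ls : Matrix ι ι ℂ[X] := Matrix.of fun i j : ι => (Gs.submatrix (R i) (C j)).det with hLs_def
  have hentry_aff : ∀ i j, aff j = true → Ls i j = Polynomial.C ((G'.submatrix (R i) (C j)).det) +
      X * Polynomial.C ((G'.submatrix (R i) (Function.update (C j) (qx j) y)).det) := by
    intro i j hj
    rw [hLs_def, Matrix.of_apply, hGs_def]
    exact shear_minor_affected G' x y (R i) (C j) (hC j) (qx j) (haff j hj).1
  have hentry_unaff : ∀ i j, aff j = false →
      Ls i j = Polynomial.C ((G'.submatrix (R i) (C j)).det) := by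
    intro i j hj
    rw [hLs_def, Matrix.of_apply, hGs_def]
    rcases hunaff j hj with hx | ⟨q₁, hq₁⟩
    · exact shear_minor_const G' x y (R i) (C j) hx
    · by_cases hx : ∃ q, C j q = x
      · obtain ⟨q₀, hq₀⟩ := hx
        exact shear_minor_neutral G' x y hxy (R i) (C j) (hC j) q₀ q₁ hq₀ hq₁
      · exact shear_minor_const G' x y (R i) (C j) (fun q h => hx ⟨q, h⟩)
  have hdeg : ∀ i j, (Ls i j).natDegree ≤ (if aff j then 1 else 0) := by
    intro i j
    cases hj : aff j
    · rw [hentry_unaff i j hj, natDegree_C]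
      exact le_rfl
    · rw [hentry_aff i j hj]
      show _ ≤ 1
      refine (natDegree_add_le _ _).trans (max_le ((natDegree_C _).le.trans zero_le_one) ?_)
      exact (natDegree_mul_le).trans (by rw [natDegree_X, natDegree_C])
  have hcoeff : ∀ i j, (Ls i j).coeff (if aff j then 1 else 0) =
      (G'.submatrix (R i) (if aff j then Function.update (C j) (qx j) y else C j)).det := by
    intro i j
    cases hj : aff j
    · rw [hentry_unaff i j hj]
      simp only [Bool.false_eq_true, if_false, coeff_C_zero]
    · rw [hentry_aff i j hj]
      simp only [if_true, coeff_add, coeff_C_succ, coeff_X_mul, coeff_C_zero, zero_add]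
  have hLs : Ls.det ≠ 0 := by
    intro h0
    have hc := coeff_det_of_natDegree_le_col Ls (fun j => if aff j then 1 else 0) hdeg
    rw [h0, coeff_zero] at hc
    have hmat : (Matrix.of fun i j => (Ls i j).coeff (if aff j then 1 else 0)) =
        Matrix.of fun i j : ι => (G'.submatrix (R i)
          (if aff j then Function.update (C j) (qx j) y else C j)).det := by
      refine Matrix.ext (fun i j => ?_)
      rw [Matrix.of_apply, Matrix.of_apply, hcoeff]
    rw [hmat] at hc
    exact hG' hc.symm
  obtain ⟨t, ht⟩ := exists_eval_ne_zero_of_ne_zero _ hLs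
  refine ⟨Gs.map (Polynomial.eval t), ?_⟩
  rw [← Polynomial.coe_evalRingHom, ← map_layoutDet]
  exact ht

end Summit.ValiantsHypothesis.ValiantsHypothesis.Theorems.BarrierLever.PriorityPeeling
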